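import Summits.AtomisticToContinuum.HydrodynamicLimit.Theorems.BoxDissipativeWeakStrongRelativeEnergyStabilityGronwall
import HarnessLib

/-!
# Crux `EntropyAdmissibility` (stmt-AtomisticToContinuum-9903), line `mean_via_weak_strong` — stub C3c `stub_signedGronwall`

The landed heart `RES.stub_clampedRelEnergyGronwall` (Březina–Feireisl's weak–strong relative-energy Grönwall IN EXPECTATION over the
local Gibbs law `P_N`, clamped currency `ℰ_{Z_{a,b}}` of the cut hard-sphere law) re-run with SIGNED entropy forcing: the 1st antecedent
`Sig.stub_pathwiseSigned` (neighbour C3a) replaces `RES.sx_pathwise` (signed defect `K2f` instead of `(K2f)⁺`), the 8th antecedent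
(neighbour C3b: `K2f(t) ∈ L¹(P_N)` and `E_{P_N} K2f(t) ≤ ε` eventually) replaces `EntropyAdmissibility`.  Proof = the landed one with
four local edits (K2 threshold read off the 8th antecedent; signed pathwise inequality; the signed `K2f` is integrated; forcing
`err_N(t) = E|K1_t| + max 0 (E K2f_t) → 0` by `RES.sx_fluxClosure_velocity` and the eventual mean bound); everything else verbatim.
References: J. Březina, E. Feireisl, J. Math. Soc. Japan 70 (2018), §3.2; E. Feireisl, M. Lukáčová-Medviďová, H. Mizerová,
Found. Comput. Math. 20 (2020); H. Spohn, *Large Scale Dynamics of Interacting Particles* (1991), II §3.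
-/

noncomputable section

namespace Summit.AtomisticToContinuum.HydrodynamicLimit.Theorems.EAMeanWSc

open MeasureTheory Filter Set Function
open scoped Topology InnerProductSpace ENNReal Classical BigOperators
open Literature.MathematicalPhysics.KineticTheory Literature.Analysis.FluidPDE Literature.Analysis.FunctionSpaces
open Summit.AtomisticToContinuum.HydrodynamicLimit.Theses Summit.AtomisticToContinuum.HydrodynamicLimit.Theses.BoxDissipativeWeakStrong
open Summit.AtomisticToContinuum.HydrodynamicLimit.Theorems.RES Literature.Analysis.FluidPDE.CompressibleEuler
open Literature.Analysis.FluidPDE.CompressibleEuler.EulerPhase Literature.Analysis.FluidPDE.CompressibleEuler.StrongPointData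

/-- **C3a — the PATHWISE clamped relative-energy inequality with SIGNED entropy defect (size M; copy of
`RES.sx_pathwise` deleting its final `le_max_left`).** Along a good orbit with pairwise distinct velocities at rational
times, `e(t) − e(0) ≤ C ∫_{(0,t]} e(s) ds + |K1-defect(t)| + K2-defect(t)` (NO positive part on the K2 defect: in the proof
of `RES.sx_pathwise` the step `hD2` is an IDENTITY before `le_max_left`).  Hypothesis bundle `S` and all other binders
verbatim those of `RES.sx_pathwise` (Theorems/…RelativeEnergyStabilityGronwallPathwiseB.lean). Sources: BrezinaFeireisl2018 §3.2. -/
def Sig.stub_pathwiseSigned : Prop :=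
  ∀ (η₀ η₁ η₁B σ T : ℝ) (F χ f : ℝ → ℝ) (ρ θ : ℝ → T3 → ℝ) (u : ℝ → T3 → V3),
    (AnalyticOnNhd ℝ F (Ioo (-η₀) η₀) ∧ EqOn hsExcessFreeEnergy F (Ico 0 η₀) ∧ 0 < η₁ ∧ η₁ ≤ η₁B ∧
      2 * η₁B < η₀ ∧ 0 < σ ∧
      (∀ x, 0 < x → x * σ ^ 3 ≤ η₁B → f x = hsExcessFreeEnergy (x * σ ^ 3) ∧ χ x = hsCompressibility (x * σ ^ 3)) ∧
      (EulerEOS.monatomicExcess χ f).IsGibbs ∧ IsHardSphereEulerSolution σ T ρ u θ ∧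
      ∀ t ∈ Ico 0 T, ∀ x, ρ t x * σ ^ 3 ≤ η₁ / 2) →
    ∀ (Φ : (N : ℕ) → HardSphereFlow (Literature.Analysis.FluidPDE.Torus.geometry (Fin 3)) (hsDiameter σ N) (N + 1))
      (ℓ : ℕ → ℝ), (∀ N, 0 < ℓ N ∧ ℓ N ≤ 1) → ∀ (N : ℕ) (z : Config (N + 1) (Fin 3) T3), z ∈ (Φ N).good →
      (∀ q : ℚ, ∀ i j, i ≠ j → ((Φ N).flow (q : ℝ) z i).2 ≠ ((Φ N).flow (q : ℝ) z j).2) →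
      BoxBalanceLawsFor σ N (Φ N) (ℓ N) z → ∀ (a b : ℝ), a ≤ b → ∀ t ∈ Ico 0 T,
      ∀ (C ρs : ℝ), ((N : ℝ) + 1)⁻¹ * (ℓ N ^ 3)⁻¹ ≤ ρs →
      (∀ s ∈ Icc 0 t, ∀ (x : T3) (v : EulerPhase),
        (v = 0 ∨ (0 < dens v ∧ 0 < ien v) ∨ (0 < dens v ∧ ien v = 0 ∧ dens v ≤ ρs)) →
          reducedRHS (cutEOS σ η₁) (clamp a b) (pdAt T ρ u θ (s, x)) (dens v) (ien v) (mom v) ≤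
            C * (pdAt T ρ u θ (s, x)).relEnergyZ (cutEOS σ η₁) (clamp a b) v) →
      clampedRelEnergyObs σ η₁ a b ρ u θ N (Φ N) (ℓ N) t z - clampedRelEnergyObs σ η₁ a b ρ u θ N (Φ N) (ℓ N) 0 z ≤
        C * (∫ s in Ioc 0 t, clampedRelEnergyObs σ η₁ a b ρ u θ N (Φ N) (ℓ N) s z) +
          |(∫ x, inner ℝ (boxState (ℓ N) ((Φ N).flow t z) x).2.1 (u t x)) -
          (∫ x, inner ℝ (boxState (ℓ N) ((Φ N).flow 0 z) x).2.1 (u 0 x)) -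
          ∫ s in Ioc 0 t, ∫ x,
            (inner ℝ (boxState (ℓ N) ((Φ N).flow s z) x).2.1
                (Torus.timeDerivWithin (Ico 0 T) u s x) +
              (∑ i, ∑ j, (boxState (ℓ N) ((Φ N).flow s z) x).2.1 i *
                  (boxState (ℓ N) ((Φ N).flow s z) x).2.1 j /
                  (boxState (ℓ N) ((Φ N).flow s z) x).1 *
                Torus.partialDeriv j (fun y => u s y i) x) +
              (boxState (ℓ N) ((Φ N).flow s z) x).1 *
                  (2 / 3 * ((boxState (ℓ N) ((Φ N).flow s z) x).2.2 /
                      (boxState (ℓ N) ((Φ N).flow s z) x).1 -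
                    ‖(boxState (ℓ N) ((Φ N).flow s z) x).2.1‖ ^ 2 /
                      (2 * (boxState (ℓ N) ((Φ N).flow s z) x).1 ^ 2))) *
                  cutCompressibility η₁ ((boxState (ℓ N) ((Φ N).flow s z) x).1 * σ ^ 3) *
                Torus.divergence (u s) x)| +
          ((∫ s in Ioc 0 t, ∫ x,
            ((boxState (ℓ N) ((Φ N).flow s z) x).1 *
                  max a (min ((cutEOS σ η₁).s (boxState (ℓ N) ((Φ N).flow s z) x).1
              (2 / 3 * ((boxState (ℓ N) ((Φ N).flow s z) x).2.2 /
                  (boxState (ℓ N) ((Φ N).flow s z) x).1 -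
                ‖(boxState (ℓ N) ((Φ N).flow s z) x).2.1‖ ^ 2 /
                  (2 * (boxState (ℓ N) ((Φ N).flow s z) x).1 ^ 2)))) b) *
                Torus.timeDerivWithin (Ico 0 T) θ s x +
              max a (min ((cutEOS σ η₁).s (boxState (ℓ N) ((Φ N).flow s z) x).1
              (2 / 3 * ((boxState (ℓ N) ((Φ N).flow s z) x).2.2 /
                  (boxState (ℓ N) ((Φ N).flow s z) x).1 -
                ‖(boxState (ℓ N) ((Φ N).flow s z) x).2.1‖ ^ 2 /
                  (2 * (boxState (ℓ N) ((Φ N).flow s z) x).1 ^ 2)))) b) *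
                inner ℝ (boxState (ℓ N) ((Φ N).flow s z) x).2.1 (Torus.gradient (θ s) x))) -
          (∫ x, (boxState (ℓ N) ((Φ N).flow t z) x).1 *
              max a (min ((cutEOS σ η₁).s (boxState (ℓ N) ((Φ N).flow t z) x).1
              (2 / 3 * ((boxState (ℓ N) ((Φ N).flow t z) x).2.2 /
                  (boxState (ℓ N) ((Φ N).flow t z) x).1 -
                ‖(boxState (ℓ N) ((Φ N).flow t z) x).2.1‖ ^ 2 /
                  (2 * (boxState (ℓ N) ((Φ N).flow t z) x).1 ^ 2)))) b) * θ t x) +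
          (∫ x, (boxState (ℓ N) ((Φ N).flow 0 z) x).1 *
              max a (min ((cutEOS σ η₁).s (boxState (ℓ N) ((Φ N).flow 0 z) x).1
              (2 / 3 * ((boxState (ℓ N) ((Φ N).flow 0 z) x).2.2 /
                  (boxState (ℓ N) ((Φ N).flow 0 z) x).1 -
                ‖(boxState (ℓ N) ((Φ N).flow 0 z) x).2.1‖ ^ 2 /
                  (2 * (boxState (ℓ N) ((Φ N).flow 0 z) x).1 ^ 2)))) b) * θ 0 x))

/-- **C3c — the clamped relative-energy Grönwall in expectation with SIGNED entropy forcing (size L; copy of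
`RES.stub_clampedRelEnergyGronwall` with four local edits).** Verbatim the statement of `RES.stub_clampedRelEnergyGronwall`
with (i) the extra first antecedent C3a and (ii) `EntropyAdmissibility` replaced by the conclusion shape of C3b.  Proof edits
in the landed 280-line proof: `hK2` := the C3b hypothesis (integrability + eventual mean bound instead of a vanishing
`lintegral`); `hpath` uses C3a (signed K2 defect); in `hineq` integrate the signed `K2f` (integrable by `hK2.1`); forcing
`err_N(t) := E|K1_t| + max 0 (E K2f_t)`, which tends to `0` by K1 and `hK2.2`.  Sources: BrezinaFeireisl2018 §3.2. -/
def Sig.stub_signedGronwall : Prop :=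
  Sig.stub_pathwiseSigned →
    (∀ (f err : ℕ → ℝ → ℝ) (τ C B : ℝ), 0 ≤ τ → 0 ≤ C →
      (∀ N, ∀ t ∈ Icc 0 τ, |f N t| ≤ B) → (∀ N, Measurable (f N)) →
      (∀ N, ∀ t ∈ Icc 0 τ, f N t ≤ f N 0 + C * (∫ s in (0:ℝ)..t, f N s) + err N t) →
      (∀ t ∈ Icc 0 τ, Tendsto (fun N => err N t) atTop (𝓝 0)) →
      Tendsto (fun N => f N 0) atTop (𝓝 0) →
      ∀ t ∈ Icc 0 τ, ∀ ε > (0:ℝ), ∀ᶠ N in atTop, f N t ≤ ε) →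
    (∀ (ε : ℝ) (n : ℕ) (Φ : HardSphereFlow (Literature.Analysis.FluidPDE.Torus.geometry (Fin 3)) ε n),
      ∃ Ψ : ℝ × Config n (Fin 3) T3 → Config n (Fin 3) T3, Measurable Ψ ∧
        ∀ (t : ℝ), ∀ z ∈ Φ.good, Ψ (t, z) = Φ.flow t z) →
    (∀ σ : ℝ, 0 < σ → ∀ (N : ℕ)
      (Φ : HardSphereFlow (Literature.Analysis.FluidPDE.Torus.geometry (Fin 3)) (hsDiameter σ N) (N + 1))
      (l : ℝ), 0 < l → l ≤ 1 → ∀ z ∈ Φ.good, BoxBalanceLawsFor σ N Φ l z) →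
    (BoxDissipativeWeakStrong.HsEosLowDensity →
      ∃ ηm : ℝ, 0 < ηm ∧ ∀ η₁ : ℝ, 0 < η₁ → η₁ < ηm → ∀ σ : ℝ, 0 < σ → CutEosMasterFor σ η₁) →
    (∀ (a₀ θ₀ : T3 → ℝ) (u₀ : T3 → V3), Continuous a₀ → Continuous θ₀ → Continuous u₀ →
      (∀ x, 0 < a₀ x) → (∀ x, 0 < θ₀ x) → EnergyMomentFor a₀ u₀ θ₀) →
    BoxDissipativeWeakStrong.FluxClosure →
    (∃ ηc : ℝ, 0 < ηc ∧ ∀ η₁ : ℝ, 0 < η₁ → η₁ < ηc →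
      ∀ (a₀ θ₀ : T3 → ℝ) (u₀ : T3 → V3), Continuous a₀ → Continuous θ₀ → Continuous u₀ →
        (∀ x, 0 < a₀ x) → (∀ x, 0 < θ₀ x) →
        ∃ σ₀ : ℝ, 0 < σ₀ ∧ ∀ σ : ℝ, 0 < σ → σ < σ₀ →
          ∀ (T : ℝ) (ρ θ : ℝ → T3 → ℝ) (u : ℝ → T3 → V3), IsHardSphereEulerSolution σ T ρ u θ →
            (∀ t ∈ Ico 0 T, ∀ x, ρ t x * σ ^ 3 ≤ η₁ / 2) →
            ∀ Φ : (N : ℕ) → HardSphereFlow (Literature.Analysis.FluidPDE.Torus.geometry (Fin 3))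
                (hsDiameter σ N) (N + 1),
              TendstoHydroFieldsAt (fun N => localGibbsLaw σ a₀ u₀ θ₀ N (Φ N)) Φ ρ u θ 0 →
                ∀ ℓ : ℕ → ℝ, IsKineticWindow ℓ → ∀ τ ∈ Ico 0 T, ∀ a b : ℝ, a < b →
                  (∀ N : ℕ, Integrable (fun z => ((∫ t in Ioc 0 τ, ∫ x,
            ((boxState (ℓ N) ((Φ N).flow t z) x).1 *
                  max a (min ((cutEOS σ η₁).s (boxState (ℓ N) ((Φ N).flow t z) x).1
              (2 / 3 * ((boxState (ℓ N) ((Φ N).flow t z) x).2.2 /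
                  (boxState (ℓ N) ((Φ N).flow t z) x).1 -
                ‖(boxState (ℓ N) ((Φ N).flow t z) x).2.1‖ ^ 2 /
                  (2 * (boxState (ℓ N) ((Φ N).flow t z) x).1 ^ 2)))) b) *
                Torus.timeDerivWithin (Ico 0 T) θ t x +
              max a (min ((cutEOS σ η₁).s (boxState (ℓ N) ((Φ N).flow t z) x).1
              (2 / 3 * ((boxState (ℓ N) ((Φ N).flow t z) x).2.2 /
                  (boxState (ℓ N) ((Φ N).flow t z) x).1 -
                ‖(boxState (ℓ N) ((Φ N).flow t z) x).2.1‖ ^ 2 /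
                  (2 * (boxState (ℓ N) ((Φ N).flow t z) x).1 ^ 2)))) b) *
                inner ℝ (boxState (ℓ N) ((Φ N).flow t z) x).2.1 (Torus.gradient (θ t) x))) -
          (∫ x, (boxState (ℓ N) ((Φ N).flow τ z) x).1 *
              max a (min ((cutEOS σ η₁).s (boxState (ℓ N) ((Φ N).flow τ z) x).1
              (2 / 3 * ((boxState (ℓ N) ((Φ N).flow τ z) x).2.2 /
                  (boxState (ℓ N) ((Φ N).flow τ z) x).1 -
                ‖(boxState (ℓ N) ((Φ N).flow τ z) x).2.1‖ ^ 2 /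
                  (2 * (boxState (ℓ N) ((Φ N).flow τ z) x).1 ^ 2)))) b) * θ τ x) +
          (∫ x, (boxState (ℓ N) ((Φ N).flow 0 z) x).1 *
              max a (min ((cutEOS σ η₁).s (boxState (ℓ N) ((Φ N).flow 0 z) x).1
              (2 / 3 * ((boxState (ℓ N) ((Φ N).flow 0 z) x).2.2 /
                  (boxState (ℓ N) ((Φ N).flow 0 z) x).1 -
                ‖(boxState (ℓ N) ((Φ N).flow 0 z) x).2.1‖ ^ 2 /
                  (2 * (boxState (ℓ N) ((Φ N).flow 0 z) x).1 ^ 2)))) b) * θ 0 x)))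
                    (localGibbsLaw σ a₀ u₀ θ₀ N (Φ N))) ∧
                  ∀ ε : ℝ, 0 < ε → ∀ᶠ N : ℕ in atTop,
                    (∫ z, ((∫ t in Ioc 0 τ, ∫ x,
            ((boxState (ℓ N) ((Φ N).flow t z) x).1 *
                  max a (min ((cutEOS σ η₁).s (boxState (ℓ N) ((Φ N).flow t z) x).1
              (2 / 3 * ((boxState (ℓ N) ((Φ N).flow t z) x).2.2 /
                  (boxState (ℓ N) ((Φ N).flow t z) x).1 -
                ‖(boxState (ℓ N) ((Φ N).flow t z) x).2.1‖ ^ 2 /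
                  (2 * (boxState (ℓ N) ((Φ N).flow t z) x).1 ^ 2)))) b) *
                Torus.timeDerivWithin (Ico 0 T) θ t x +
              max a (min ((cutEOS σ η₁).s (boxState (ℓ N) ((Φ N).flow t z) x).1
              (2 / 3 * ((boxState (ℓ N) ((Φ N).flow t z) x).2.2 /
                  (boxState (ℓ N) ((Φ N).flow t z) x).1 -
                ‖(boxState (ℓ N) ((Φ N).flow t z) x).2.1‖ ^ 2 /
                  (2 * (boxState (ℓ N) ((Φ N).flow t z) x).1 ^ 2)))) b) *
                inner ℝ (boxState (ℓ N) ((Φ N).flow t z) x).2.1 (Torus.gradient (θ t) x))) -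
          (∫ x, (boxState (ℓ N) ((Φ N).flow τ z) x).1 *
              max a (min ((cutEOS σ η₁).s (boxState (ℓ N) ((Φ N).flow τ z) x).1
              (2 / 3 * ((boxState (ℓ N) ((Φ N).flow τ z) x).2.2 /
                  (boxState (ℓ N) ((Φ N).flow τ z) x).1 -
                ‖(boxState (ℓ N) ((Φ N).flow τ z) x).2.1‖ ^ 2 /
                  (2 * (boxState (ℓ N) ((Φ N).flow τ z) x).1 ^ 2)))) b) * θ τ x) +
          (∫ x, (boxState (ℓ N) ((Φ N).flow 0 z) x).1 *
              max a (min ((cutEOS σ η₁).s (boxState (ℓ N) ((Φ N).flow 0 z) x).1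
              (2 / 3 * ((boxState (ℓ N) ((Φ N).flow 0 z) x).2.2 /
                  (boxState (ℓ N) ((Φ N).flow 0 z) x).1 -
                ‖(boxState (ℓ N) ((Φ N).flow 0 z) x).2.1‖ ^ 2 /
                  (2 * (boxState (ℓ N) ((Φ N).flow 0 z) x).1 ^ 2)))) b) * θ 0 x))
                      ∂(localGibbsLaw σ a₀ u₀ θ₀ N (Φ N))) ≤ ε) →
    BoxDissipativeWeakStrong.HsEosLowDensity →
      ∃ ηb : ℝ, 0 < ηb ∧ ∀ η₁ : ℝ, 0 < η₁ → η₁ < ηb →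
        ∀ (a₀ θ₀ : T3 → ℝ) (u₀ : T3 → V3), Continuous a₀ → Continuous θ₀ → Continuous u₀ →
          (∀ x, 0 < a₀ x) → (∀ x, 0 < θ₀ x) →
          ∃ σ₀ : ℝ, 0 < σ₀ ∧ ∀ σ : ℝ, 0 < σ → σ < σ₀ →
            ∀ (T : ℝ) (ρ θ : ℝ → T3 → ℝ) (u : ℝ → T3 → V3), IsHardSphereEulerSolution σ T ρ u θ →
              (∀ t ∈ Ico 0 T, ∀ x, ρ t x * σ ^ 3 ≤ η₁ / 2) →
              ∀ Φ : (N : ℕ) → HardSphereFlow (Literature.Analysis.FluidPDE.Torus.geometry (Fin 3))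
                  (hsDiameter σ N) (N + 1),
                TendstoHydroFieldsAt (fun N => localGibbsLaw σ a₀ u₀ θ₀ N (Φ N)) Φ ρ u θ 0 →
                  ∀ ℓ : ℕ → ℝ, IsKineticWindow ℓ →
                    ∀ τ ∈ Ico 0 T, ∀ a b : ℝ, ClampAdmissible σ η₁ a b ρ θ τ →
                      BoxClampedRelEnergyVanishesAt σ η₁ a b a₀ u₀ θ₀ Φ ρ u θ ℓ 0 →
                        BoxClampedRelEnergyVanishesAt σ η₁ a b a₀ u₀ θ₀ Φ ρ u θ ℓ τ

/-- **C3c — the clamped relative-energy Grönwall in expectation with SIGNED entropy forcing** (Březina–Feireisl §3.2 over `P_N`): the landed proof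
of `RES.stub_clampedRelEnergyGronwall` with the signed pathwise inequality (1st antecedent), the mean entropy forcing (8th) and `err_N = E|K1| + max 0 (E K2f)`. -/
theorem stub_signedGronwall : Sig.stub_signedGronwall := by
  intro hPW hG hJ hB hM hE hFC hK2all hEos
  -- thresholds
  obtain ⟨ηc1, hηc1, hK1⟩ := sx_fluxClosure_velocity hFC hEos
  obtain ⟨ηc2, hηc2, hK2⟩ := hK2all
  obtain ⟨ηm, hηm, hHM⟩ := hM hEos
  obtain ⟨η₀, hη₀, F, hFan, hFeq, -⟩ := hEos
  obtain ⟨ηd, hηd, -, hco⟩ := co_pointwise_estimate hη₀ hFan hFeq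
  obtain ⟨η₁B, hη₁B, h2B, hext⟩ := cm_band_extension hη₀ hFan hFeq
  obtain ⟨ηe, hηe, hsmall⟩ := sx_smallness hη₀ hFan hFeq
  refine ⟨min (min (min ηc1 ηc2) (min ηm ηd)) (min η₁B ηe), by positivity, ?_⟩
  intro η₁ hη₁ hη₁b a₀ θ₀ u₀ ha hθ hu ha0 hθ0
  have hη₁c1 : η₁ < ηc1 := hη₁b.trans_le ((min_le_left _ _).trans ((min_le_left _ _).trans (min_le_left _ _)))
  have hη₁c2 : η₁ < ηc2 := hη₁b.trans_le ((min_le_left _ _).trans ((min_le_left _ _).trans (min_le_right _ _)))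
  have hη₁m : η₁ < ηm := hη₁b.trans_le ((min_le_left _ _).trans ((min_le_right _ _).trans (min_le_left _ _)))
  have hη₁d' : η₁ < ηd := hη₁b.trans_le ((min_le_left _ _).trans ((min_le_right _ _).trans (min_le_right _ _)))
  have hη₁B' : η₁ ≤ η₁B := (hη₁b.trans_le ((min_le_right _ _).trans (min_le_left _ _))).le
  have hη₁e : η₁ < ηe := hη₁b.trans_le ((min_le_right _ _).trans (min_le_right _ _))
  obtain ⟨hW', hZ1, hZpos⟩ := hsmall η₁ hη₁ hη₁e
  obtain ⟨σ₁, hσ₁, hK1'⟩ := hK1 η₁ hη₁ hη₁c1 a₀ θ₀ u₀ ha hθ hu ha0 hθ0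
  obtain ⟨σ₂, hσ₂, hK2'⟩ := hK2 η₁ hη₁ hη₁c2 a₀ θ₀ u₀ ha hθ hu ha0 hθ0
  obtain ⟨CE, hCE, hEM⟩ := hE a₀ θ₀ u₀ ha hθ hu ha0 hθ0
  refine ⟨min (1 / 2) (min σ₁ σ₂), by positivity, ?_⟩
  intro σ hσ hσ0 T ρ θ u hsol hguard Φ hLLN ℓ hℓw τ hτ a b hadm hV0
  have hσ2 : σ ≤ 1 / 2 := (hσ0.trans_le (min_le_left _ _)).le
  have hσσ₁ : σ < σ₁ := hσ0.trans_le ((min_le_right _ _).trans (min_le_left _ _))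
  have hσσ₂ : σ < σ₂ := hσ0.trans_le ((min_le_right _ _).trans (min_le_right _ _))
  obtain ⟨χ, f, hχ2, hf2, hvir, -, -, hagree⟩ := hext σ hσ
  have hGB : (EulerEOS.monatomicExcess χ f).IsGibbs := monatomicExcess_isGibbs χ f (hχ2.of_le one_le_two) (hf2.of_le one_le_two) hvir
  have S : AnalyticOnNhd ℝ F (Ioo (-η₀) η₀) ∧ EqOn hsExcessFreeEnergy F (Ico 0 η₀) ∧ 0 < η₁ ∧ η₁ ≤ η₁B ∧ 2 * η₁B < η₀ ∧ 0 < σ ∧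
      (∀ x, 0 < x → x * σ ^ 3 ≤ η₁B → f x = hsExcessFreeEnergy (x * σ ^ 3) ∧ χ x = hsCompressibility (x * σ ^ 3)) ∧
      (EulerEOS.monatomicExcess χ f).IsGibbs ∧ IsHardSphereEulerSolution σ T ρ u θ ∧ ∀ t ∈ Ico 0 T, ∀ x, ρ t x * σ ^ 3 ≤ η₁ / 2 :=
    ⟨hFan, hFeq, hη₁, hη₁B', h2B, hσ, hagree, hGB, hsol, hguard⟩
  have hT : 0 < T := hτ.1.trans_lt hτ.2
  have hℓ : ∀ N, 0 < ℓ N ∧ ℓ N ≤ 1 := hℓw.1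
  have hIcc : Icc 0 τ ⊆ Ico 0 T := fun t ht => ⟨ht.1, ht.2.trans_lt hτ.2⟩
  have hab : a ≤ b := hadm.1.le
  -- the local Gibbs laws are probability measures; jointly measurable versions of the flows
  haveI hP : ∀ N, IsProbabilityMeasure (localGibbsLaw σ a₀ u₀ θ₀ N (Φ N)) := fun N => isProbabilityMeasure_localGibbsLaw ha hθ hu ha0 hθ0 hσ2 N (Φ N)
  choose Ψ hΨm hΨeq using fun N => hJ (hsDiameter σ N) (N + 1) (Φ N)
  -- sharp domination, master constant, nonnegativity scales, the threshold `N₀`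
  obtain ⟨A, Bc, hA, hBc, hAB⟩ := sx_obs_abs_le S hτ hab
  have hABz : ∀ N, ∀ z ∈ (Φ N).good, ∀ s ∈ Icc 0 τ, |clampedRelEnergyObs σ η₁ a b ρ u θ N (Φ N) (ℓ N) s z| ≤ A + Bc * (((N : ℝ) + 1)⁻¹ * configEnergy z) :=
    fun N z hz s hs => hAB N (Φ N) (ℓ N) z (hB σ hσ N (Φ N) (ℓ N) (hℓ N).1 (hℓ N).2 z hz) s hs
  obtain ⟨C, ρs, hC0, hρs, hmaster⟩ := sx_master_constant S (hHM η₁ hη₁ hη₁m σ hσ) hW' hZ1 hZpos hτ hadm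
  obtain ⟨ρs0, hρs0, hco0⟩ := hco η₁ hη₁ hη₁d' σ hσ T ρ θ u hsol 0 ⟨le_rfl, hT⟩ a b (clampAdmissible_mono hadm hτ.1)
  obtain ⟨ρsτ, hρsτ, hcoτ⟩ := hco η₁ hη₁ hη₁d' σ hσ T ρ θ u hsol τ hτ a b hadm
  obtain ⟨K0, -, hP0⟩ := hco0 1 one_pos
  obtain ⟨Kτ, -, hPτ⟩ := hcoτ 1 one_pos
  obtain ⟨N₀, hN₀⟩ := eventually_atTop.1 (sx_window_eventually hℓw (lt_min hρs (lt_min hρs0 hρsτ)))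
  -- a.e.: good data with pairwise distinct velocities at rational times
  have hae : ∀ N, ∀ᵐ z ∂(localGibbsLaw σ a₀ u₀ θ₀ N (Φ N)), z ∈ (Φ N).good ∧
      ∀ q : ℚ, ∀ i j, i ≠ j → ((Φ N).flow (q : ℝ) z i).2 ≠ ((Φ N).flow (q : ℝ) z j).2 := fun N => sx_ae_rational_distinct N (Φ N)
  -- integrability of the observable and of its time integral; the Grönwall function; Fubini
  have hint : ∀ N, ∀ s ∈ Icc 0 τ, Integrable (fun z => clampedRelEnergyObs σ η₁ a b ρ u θ N (Φ N) (ℓ N) s z) (localGibbsLaw σ a₀ u₀ θ₀ N (Φ N)) :=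
    fun N s hs => sx_integrable_obs S ha hθ hu ha0 hθ0 hσ2 (Φ N) (hΨm N) (hΨeq N) (hℓ N).1 hab hτ (hABz N) hs
  have hintI : ∀ N, ∀ t ∈ Icc 0 τ, Integrable (fun z => ∫ s in Ioc 0 t, clampedRelEnergyObs σ η₁ a b ρ u θ N (Φ N) (ℓ N) s z) (localGibbsLaw σ a₀ u₀ θ₀ N (Φ N)) :=
    fun N t ht => sx_integrable_timeIntegral_obs S ha hθ hu ha0 hθ0 hσ2 (Φ N) (hΨm N) (hΨeq N) (hℓ N).1 hab hτ (hABz N) ht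
  obtain ⟨fN, hfN⟩ : ∃ fN : ℕ → ℝ → ℝ, fN = fun N t => ∫ z, (∫ x, clampedRelEnergy σ η₁ a b (ρ (max 0 (min t τ)) x) (u (max 0 (min t τ)) x)
      (θ (max 0 (min t τ)) x) (boxState (ℓ N) (Ψ N (max 0 (min t τ), z)) x)) ∂(localGibbsLaw σ a₀ u₀ θ₀ N (Φ N)) := ⟨_, rfl⟩
  have hfN_eq : ∀ N, ∀ t ∈ Icc 0 τ, fN N t = ∫ z, clampedRelEnergyObs σ η₁ a b ρ u θ N (Φ N) (ℓ N) t z ∂(localGibbsLaw σ a₀ u₀ θ₀ N (Φ N)) :=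
    fun N t ht => by rw [hfN]; exact integral_congr_ae ((hae N).mono fun z hz => ex_obsPsi_eq (Φ N) (hΨeq N) (ℓ N) a b hz.1 ht)
  have hfubini : ∀ N, ∀ t ∈ Icc 0 τ,
      ∫ z, (∫ s in Ioc 0 t, clampedRelEnergyObs σ η₁ a b ρ u θ N (Φ N) (ℓ N) s z) ∂(localGibbsLaw σ a₀ u₀ θ₀ N (Φ N)) = ∫ s in (0:ℝ)..t, fN N s := by
    intro N t ht
    rw [intervalIntegral.integral_of_le ht.1, hfN]
    exact sx_fubini_obs S ha hθ hu ha0 hθ0 hσ2 (Φ N) (hΨm N) (hΨeq N) (hℓ N).1 hab hτ (hABz N) ht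
  -- nonnegativity at times `0` and `τ` beyond the threshold
  have hnonneg : ∀ N, N₀ ≤ N → ∀ s, (s = 0 ∨ s = τ) → 0 ≤ᵐ[localGibbsLaw σ a₀ u₀ θ₀ N (Φ N)] fun z => clampedRelEnergyObs σ η₁ a b ρ u θ N (Φ N) (ℓ N) s z := by
    intro N hN s hs; have hth := hN₀ N hN
    filter_upwards [hae N] with z hz
    have hdist := ad_distinct_of_rational (Φ N) hz.1 hz.2 s
    rcases hs with rfl | rfl
    · exact sx_obs_nonneg (fun x U h1 h2 h3 h4 => (hP0 x U h1 h2 h3 h4).1) (hℓ N).1.le _ hdist (hth.trans ((min_le_right _ _).trans (min_le_left _ _)))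
    · exact sx_obs_nonneg (fun x U h1 h2 h3 h4 => (hPτ x U h1 h2 h3 h4).1) (hℓ N).1.le _ hdist (hth.trans ((min_le_right _ _).trans (min_le_right _ _)))
  -- (a) uniform bound, (b) measurability, (c) `f_N(0) → 0`
  have hKE0 : ∀ (n : ℕ) (z : Config n (Fin 3) T3), 0 ≤ configEnergy z := fun n z => by unfold configEnergy; positivity
  have hbound : ∀ N, ∀ t ∈ Icc 0 τ, |fN N t| ≤ A + Bc * CE.toReal := by
    intro N t ht; rw [hfN_eq N t ht]
    have h1 : ‖∫ z, clampedRelEnergyObs σ η₁ a b ρ u θ N (Φ N) (ℓ N) t z ∂(localGibbsLaw σ a₀ u₀ θ₀ N (Φ N))‖ ≤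
        ∫ z, (A + Bc * (((N : ℝ) + 1)⁻¹ * configEnergy z)) ∂(localGibbsLaw σ a₀ u₀ θ₀ N (Φ N)) :=
      norm_integral_le_of_norm_le (ex_integrable_dom ha hθ hu ha0 hθ0 hσ2 (Φ N) A Bc) ((hae N).mono fun z hz => by rw [Real.norm_eq_abs]; exact hABz N z hz.1 t ht)
    rw [Real.norm_eq_abs] at h1
    refine h1.trans ?_
    have hKEi : Integrable (fun z : Config (N + 1) (Fin 3) T3 => ((N : ℝ) + 1)⁻¹ * configEnergy z) (localGibbsLaw σ a₀ u₀ θ₀ N (Φ N)) :=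
      (EABirthS1a.integrable_configEnergy_localGibbsLaw ha hθ hu (fun x => (ha0 x).le) hθ0 σ N (Φ N)).const_mul _
    rw [integral_add (integrable_const A) (hKEi.const_mul Bc), integral_const, integral_const_mul]
    simp only [Measure.real, measure_univ, ENNReal.toReal_one, one_smul]
    have h2 : ∫ z, ((N : ℝ) + 1)⁻¹ * configEnergy z ∂(localGibbsLaw σ a₀ u₀ θ₀ N (Φ N)) ≤ CE.toReal := by
      rw [integral_eq_lintegral_of_nonneg_ae (ae_of_all _ fun z => by positivity [hKE0 _ z]) hKEi.aestronglyMeasurable]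
      exact ENNReal.toReal_mono hCE (hEM σ hσ N (Φ N)).2
    nlinarith [h2, hBc]
  have hmeas : ∀ N, Measurable (fN N) := fun N => by rw [hfN]; exact sx_measurable_mean S ha hθ hu ha0 hθ0 hσ2 (Φ N) (hΨm N) (hℓ N).1 a b hτ
  have hf0 : Tendsto (fun N => fN N 0) atTop (𝓝 0) := by
    have hlim := (ENNReal.tendsto_toReal ENNReal.zero_ne_top).comp hV0
    rw [ENNReal.toReal_zero] at hlim
    refine hlim.congr' ?_
    filter_upwards [eventually_ge_atTop N₀] with N hN
    rw [Function.comp_apply, hfN_eq N 0 ⟨le_rfl, hτ.1⟩, integral_eq_lintegral_of_nonneg_ae (hnonneg N hN 0 (Or.inl rfl)) (hint N 0 ⟨le_rfl, hτ.1⟩).aestronglyMeasurable]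
  -- the K1 / K2 functionals (opaque names with defining equations)
  obtain ⟨K1a, hK1a⟩ : ∃ K1a : (N : ℕ) → ℝ → Config (N + 1) (Fin 3) T3 → ℝ, K1a = fun N t z =>
      (|(∫ x, inner ℝ (boxState (ℓ N) ((Φ N).flow t z) x).2.1 (u t x)) - (∫ x, inner ℝ (boxState (ℓ N) ((Φ N).flow 0 z) x).2.1 (u 0 x)) -
          ∫ s in Ioc 0 t, ∫ x, (inner ℝ (boxState (ℓ N) ((Φ N).flow s z) x).2.1 (Torus.timeDerivWithin (Ico 0 T) u s x) +
            (∑ i, ∑ j, (boxState (ℓ N) ((Φ N).flow s z) x).2.1 i * (boxState (ℓ N) ((Φ N).flow s z) x).2.1 j / (boxState (ℓ N) ((Φ N).flow s z) x).1 *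
              Torus.partialDeriv j (fun y => u s y i) x) +
            (boxState (ℓ N) ((Φ N).flow s z) x).1 * (2 / 3 * ((boxState (ℓ N) ((Φ N).flow s z) x).2.2 / (boxState (ℓ N) ((Φ N).flow s z) x).1 -
              ‖(boxState (ℓ N) ((Φ N).flow s z) x).2.1‖ ^ 2 / (2 * (boxState (ℓ N) ((Φ N).flow s z) x).1 ^ 2))) *
              cutCompressibility η₁ ((boxState (ℓ N) ((Φ N).flow s z) x).1 * σ ^ 3) * Torus.divergence (u s) x)|) := ⟨_, rfl⟩
  obtain ⟨K2f, hK2f⟩ : ∃ K2f : (N : ℕ) → ℝ → Config (N + 1) (Fin 3) T3 → ℝ, K2f = fun N t z =>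
      ((∫ s in Ioc 0 t, ∫ x, ((boxState (ℓ N) ((Φ N).flow s z) x).1 * max a (min ((cutEOS σ η₁).s (boxState (ℓ N) ((Φ N).flow s z) x).1
            (2 / 3 * ((boxState (ℓ N) ((Φ N).flow s z) x).2.2 / (boxState (ℓ N) ((Φ N).flow s z) x).1 -
              ‖(boxState (ℓ N) ((Φ N).flow s z) x).2.1‖ ^ 2 / (2 * (boxState (ℓ N) ((Φ N).flow s z) x).1 ^ 2)))) b) * Torus.timeDerivWithin (Ico 0 T) θ s x +
          max a (min ((cutEOS σ η₁).s (boxState (ℓ N) ((Φ N).flow s z) x).1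
            (2 / 3 * ((boxState (ℓ N) ((Φ N).flow s z) x).2.2 / (boxState (ℓ N) ((Φ N).flow s z) x).1 -
              ‖(boxState (ℓ N) ((Φ N).flow s z) x).2.1‖ ^ 2 / (2 * (boxState (ℓ N) ((Φ N).flow s z) x).1 ^ 2)))) b) * inner ℝ (boxState (ℓ N) ((Φ N).flow s z) x).2.1 (Torus.gradient (θ s) x))) -
        (∫ x, (boxState (ℓ N) ((Φ N).flow t z) x).1 * max a (min ((cutEOS σ η₁).s (boxState (ℓ N) ((Φ N).flow t z) x).1
            (2 / 3 * ((boxState (ℓ N) ((Φ N).flow t z) x).2.2 / (boxState (ℓ N) ((Φ N).flow t z) x).1 -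
              ‖(boxState (ℓ N) ((Φ N).flow t z) x).2.1‖ ^ 2 / (2 * (boxState (ℓ N) ((Φ N).flow t z) x).1 ^ 2)))) b) * θ t x) +
        (∫ x, (boxState (ℓ N) ((Φ N).flow 0 z) x).1 * max a (min ((cutEOS σ η₁).s (boxState (ℓ N) ((Φ N).flow 0 z) x).1
            (2 / 3 * ((boxState (ℓ N) ((Φ N).flow 0 z) x).2.2 / (boxState (ℓ N) ((Φ N).flow 0 z) x).1 -
              ‖(boxState (ℓ N) ((Φ N).flow 0 z) x).2.1‖ ^ 2 / (2 * (boxState (ℓ N) ((Φ N).flow 0 z) x).1 ^ 2)))) b) * θ 0 x)) := ⟨_, rfl⟩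
  have hK1t : ∀ t ∈ Ico 0 T, Tendsto (fun N => ∫⁻ z, ENNReal.ofReal (K1a N t z) ∂(localGibbsLaw σ a₀ u₀ θ₀ N (Φ N))) atTop (𝓝 0) := by
    intro t ht; rw [hK1a]; exact hK1' σ hσ hσσ₁ T ρ θ u hsol hguard Φ hLLN ℓ hℓw t ht
  have hK1m : ∀ N, ∀ t ∈ Ico 0 T, AEMeasurable (K1a N t) (localGibbsLaw σ a₀ u₀ θ₀ N (Φ N)) := by
    intro N t ht; rw [hK1a]; exact sx_aemeasurable_K1 hsol.smooth_velocity a₀ θ₀ u₀ Φ ℓ hℓ N ht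
  have hK1nn : ∀ N t z, 0 ≤ K1a N t z := by intro N t z; rw [hK1a]; exact abs_nonneg _
  -- the MEAN entropy forcing (8th antecedent): integrability and the eventual mean bound of the signed `K2f`
  have hK2t : ∀ t ∈ Ico 0 T, (∀ N, Integrable (K2f N t) (localGibbsLaw σ a₀ u₀ θ₀ N (Φ N))) ∧
      ∀ ε : ℝ, 0 < ε → ∀ᶠ N : ℕ in atTop, (∫ z, K2f N t z ∂(localGibbsLaw σ a₀ u₀ θ₀ N (Φ N))) ≤ ε := by
    intro t ht; rw [hK2f]; exact hK2' σ hσ hσσ₂ T ρ θ u hsol hguard Φ hLLN ℓ hℓw t ht a b hadm.1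
  -- the pathwise inequality with SIGNED entropy defect (1st antecedent), a.s., beyond the threshold
  have hpath : ∀ N, N₀ ≤ N → ∀ t ∈ Icc 0 τ, ∀ᵐ z ∂(localGibbsLaw σ a₀ u₀ θ₀ N (Φ N)),
      clampedRelEnergyObs σ η₁ a b ρ u θ N (Φ N) (ℓ N) t z - clampedRelEnergyObs σ η₁ a b ρ u θ N (Φ N) (ℓ N) 0 z ≤
        C * (∫ s in Ioc 0 t, clampedRelEnergyObs σ η₁ a b ρ u θ N (Φ N) (ℓ N) s z) + K1a N t z + K2f N t z := by
    intro N hN t ht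
    have hth : ((N : ℝ) + 1)⁻¹ * (ℓ N ^ 3)⁻¹ ≤ ρs := (hN₀ N hN).trans (min_le_left _ _)
    filter_upwards [hae N] with z hz
    rw [hK1a, hK2f]
    exact hPW _ _ _ _ _ _ _ _ _ _ _ S Φ ℓ hℓ N z hz.1 hz.2 (hB σ hσ N (Φ N) (ℓ N) (hℓ N).1 (hℓ N).2 z hz.1) a b hab t (hIcc ht) C ρs hth
      fun s hs x v hv => hmaster s ⟨hs.1, hs.2.trans ht.2⟩ x v hv
  -- the forcing
  obtain ⟨errN, herrN⟩ : ∃ errN : ℕ → ℝ → ℝ, errN = fun N t =>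
      if N₀ ≤ N ∧ (∫⁻ z, ENNReal.ofReal (K1a N t z) ∂(localGibbsLaw σ a₀ u₀ θ₀ N (Φ N))) ≠ ∞ then
        (∫⁻ z, ENNReal.ofReal (K1a N t z) ∂(localGibbsLaw σ a₀ u₀ θ₀ N (Φ N))).toReal + max 0 (∫ z, K2f N t z ∂(localGibbsLaw σ a₀ u₀ θ₀ N (Φ N)))
      else fN N t - fN N 0 - C * ∫ s in (0:ℝ)..t, fN N s := ⟨_, rfl⟩
  -- (d) the integral inequality
  have hineq : ∀ N, ∀ t ∈ Icc 0 τ, fN N t ≤ fN N 0 + C * (∫ s in (0:ℝ)..t, fN N s) + errN N t := by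
    intro N t ht
    rw [herrN]; dsimp only
    split_ifs with hcase
    · obtain ⟨hN, h1fin⟩ := hcase
      have ht' : t ∈ Ico 0 T := hIcc ht
      have h0 : (0 : ℝ) ∈ Icc 0 τ := ⟨le_rfl, hτ.1⟩
      have hK1i : Integrable (K1a N t) (localGibbsLaw σ a₀ u₀ θ₀ N (Φ N)) :=
        ⟨(hK1m N t ht').aestronglyMeasurable, (hasFiniteIntegral_iff_ofReal (ae_of_all _ (hK1nn N t))).2 (lt_top_iff_ne_top.2 h1fin)⟩
      have hK2i : Integrable (K2f N t) (localGibbsLaw σ a₀ u₀ θ₀ N (Φ N)) := (hK2t t ht').1 N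
      have hIi := (hintI N t ht).const_mul C
      have hmono := integral_mono_ae ((hint N t ht).sub (hint N 0 h0)) ((hIi.add hK1i).add hK2i) (hpath N hN t ht)
      simp only [Pi.add_apply, Pi.sub_apply] at hmono
      have i1 := integral_sub (hint N t ht) (hint N 0 h0); have i2 := integral_add (hIi.add hK1i) hK2i; have i3 := integral_add hIi hK1i
      simp only [Pi.add_apply] at i2 i3
      have i4 : ∫ z, C * (∫ s in Ioc 0 t, clampedRelEnergyObs σ η₁ a b ρ u θ N (Φ N) (ℓ N) s z) ∂(localGibbsLaw σ a₀ u₀ θ₀ N (Φ N)) = C * ∫ s in (0:ℝ)..t, fN N s := by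
        rw [integral_const_mul, hfubini N t ht]
      have i5 : ∫ z, K1a N t z ∂(localGibbsLaw σ a₀ u₀ θ₀ N (Φ N)) = (∫⁻ z, ENNReal.ofReal (K1a N t z) ∂(localGibbsLaw σ a₀ u₀ θ₀ N (Φ N))).toReal :=
        integral_eq_lintegral_of_nonneg_ae (ae_of_all _ (hK1nn N t)) hK1i.aestronglyMeasurable
      have i7 := le_max_right 0 (∫ z, K2f N t z ∂(localGibbsLaw σ a₀ u₀ θ₀ N (Φ N)))
      rw [i1, i2, i3, i4, i5, ← hfN_eq N t ht, ← hfN_eq N 0 h0] at hmono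
      linarith
    · linarith
  -- (e) the forcing vanishes
  have herr : ∀ t ∈ Icc 0 τ, Tendsto (fun N => errN N t) atTop (𝓝 0) := by
    intro t ht
    have ht' : t ∈ Ico 0 T := hIcc ht
    have hK2lim : Tendsto (fun N => max 0 (∫ z, K2f N t z ∂(localGibbsLaw σ a₀ u₀ θ₀ N (Φ N)))) atTop (𝓝 0) :=
      tendsto_order.2 ⟨fun a' ha' => Eventually.of_forall fun N => ha'.trans_le (le_max_left _ _),
        fun a' ha' => ((hK2t t ht').2 (a' / 2) (half_pos ha')).mono fun N hN => max_lt ha' (hN.trans_lt (half_lt_self ha'))⟩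
    have hlim := ((ENNReal.tendsto_toReal ENNReal.zero_ne_top).comp (hK1t t ht')).add hK2lim
    rw [ENNReal.toReal_zero, add_zero] at hlim
    refine hlim.congr' ?_
    have h1 : ∀ᶠ N in atTop, (∫⁻ z, ENNReal.ofReal (K1a N t z) ∂(localGibbsLaw σ a₀ u₀ θ₀ N (Φ N))) < 1 := (hK1t t ht').eventually (gt_mem_nhds zero_lt_one)
    filter_upwards [h1, eventually_ge_atTop N₀] with N hN1 hN
    rw [herrN]; dsimp only; rw [if_pos ⟨hN, (hN1.trans ENNReal.one_lt_top).ne⟩]; rfl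
  -- (f) forced Grönwall, (g) back to the clamped vanishing at `τ`
  have hGτ := hG fN errN τ C (A + Bc * CE.toReal) hτ.1 hC0 hbound hmeas hineq herr hf0 τ ⟨hτ.1, le_rfl⟩
  have hτI : τ ∈ Icc 0 τ := ⟨hτ.1, le_rfl⟩
  have hfτ0 : ∀ᶠ N in atTop, 0 ≤ fN N τ := by
    filter_upwards [eventually_ge_atTop N₀] with N hN; rw [hfN_eq N τ hτI]; exact integral_nonneg_of_ae (hnonneg N hN τ (Or.inr rfl))
  have hlim := ENNReal.tendsto_ofReal (sx_tendsto_zero_of_eventually_le hfτ0 hGτ)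
  rw [ENNReal.ofReal_zero] at hlim
  refine hlim.congr' ?_
  filter_upwards [eventually_ge_atTop N₀] with N hN
  rw [hfN_eq N τ hτI, ofReal_integral_eq_lintegral_ofReal (hint N τ hτI) (hnonneg N hN τ (Or.inr rfl))]

end Summit.AtomisticToContinuum.HydrodynamicLimit.Theorems.EAMeanWSc

end
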